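import Summits.NavierStokesRegularity.FunctionalMining.TopEigSaturatingModuli
import Summits.NavierStokesRegularity.FunctionalMining.TopEigHeatCoercive
import Mathlib.Analysis.Calculus.MeanValue
import HarnessLib

/-!
# FunctionalMining — Lemma L-λ turns the ε-uniform inequality into a slope bound (Dini fencing)

Search for candidate a priori estimates; no regularity claim. Cell `pub-nsfunc`, prove seat
(gen 17). The limiting step of Theorem G (ii) of SIEVELD §3.4 (`TopEigTLDOfCoercive`) in the kernel,
for the NON-smooth moment `Φ(v) = ∫ g(S_v)^q` of an admissible density (`g = λ₁`, `−λ₃`), WITHOUT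
ever differentiating `s ↦ Φ(u s)`:

* `TopEig.continuousOn_integral_comp_strain` — `s ↦ ∫ g(S(w s))^r` is continuous along a jointly
  smooth field (tube lemma over the compact torus);
* `TopEig.exists_heatLine_quotient_ge` — the dictionary's `heatDissipation Φ v` (a supremum over the
  heat line) is approached by the quotients `(Φ v − Φ(v + τΔv))/τ`, `τ → 0⁺` (convexity,
  `TopEig.heatDissipation_eq_neg_rightDeriv`);
* `TopEig.slope_lt_of_heatCoercive` — THE SLOPE LEMMA: if `c Φ ≤ heatDissipation Φ` (Lemma L-λ at
  rate `c`, hypothesis `HeatCoercive Φ c`) and `2β ≤ (1−β)c`, then at every time `x` of a zero-mean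
  classical solution, for every `r` exceeding `K ≥ K_c ν^{−γ} (2ℰ) Φ^{1+1/σ}` on the window, the
  right slopes `(Φ(u z) − Φ(u x))/(z − x)` are eventually `< r` (choose `τ` at the point `x`, continuity
  in time of the quotient for that `τ`, the ε-uniform inequality of `TopEigSaturatingModuli`, the mean
  value inequality for `F_ε`, `ε → 0`);
* `TopEig.sub_le_mul_of_heatCoercive` — hence, by the Dini fencing theorem
  (`image_le_of_liminf_slope_right_le_deriv_boundary`, linear comparison function):
  `Φ(u s) − Φ(u a) ≤ K (s − a)` on the window.

[ours]
-/

noncomputable section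

open MeasureTheory Set Filter Topology Finset
open scoped InnerProductSpace RealInnerProductSpace ContDiff

namespace Summit.NavierStokesRegularity.FunctionalMining

open Literature.Analysis.FunctionSpaces Literature.Analysis.FluidPDE

namespace TopEig

open StrainL4 StrainMoment VorticityL4 StrainTensor

/-! ## 1. Continuity in time of `∫ g(S)^r` -/

/-- `s ↦ ∫ g(S(w s))^r` is continuous on `S` for a jointly smooth `w`, continuous `g`, `r ≥ 0`.
[folklore] -/
theorem continuousOn_integral_comp_strain {d : Type*} [Fintype d] [DecidableEq d] {S : Set ℝ}
    (hS : UniqueDiffOn ℝ S) {w : ℝ → UnitAddTorus d → EuclideanSpace ℝ d}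
    (hw : Torus.IsSmoothSpaceTimeOn S w) {g : EuclideanSpace ℝ (d × d) → ℝ} (hg : Continuous g)
    {r : ℝ} (hr : 0 ≤ r) : ContinuousOn (fun s => ∫ y, g (strainFlat (w s) y) ^ r) S := by
  have hΘ := isSmoothSpaceTimeOn_strainFlat hw hS
  have hc : ContinuousOn (Torus.stLift fun s y => g (strainFlat (w s) y) ^ r) (S ×ˢ univ) :=
    (hg.rpow_const fun _ => Or.inr hr).comp_continuousOn hΘ.continuousOn_stLift
  exact Torus.continuousOn_integral_of_continuousOn_stLift hc

/-! ## 2. The heat-line quotient approaches `heatDissipation` -/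

/-- For `Φ(v) = ∫ g(S_v)^q` on smooth divergence-free fields (`g` convex continuous, `≥ 0` there,
`q ≥ 1`) and a smooth divergence-free `v`: for every `δ > 0` there is `τ > 0` with
`heatDissipation Φ v − δ ≤ (Φ v − Φ(v + τΔv))/τ`. [ours] -/
theorem exists_heatLine_quotient_ge {q : ℝ} (hq : 1 ≤ q)
    {g : EuclideanSpace ℝ (Fin 3 × Fin 3) → ℝ} (hconv : ConvexOn ℝ univ g) (hgc : Continuous g)
    (hg0 : ∀ v : UnitAddTorus (Fin 3) → EuclideanSpace ℝ (Fin 3), Torus.IsSmooth v →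
      Torus.IsDivFree v → ∀ x, 0 ≤ g (strainFlat v x))
    {Φ : (UnitAddTorus (Fin 3) → EuclideanSpace ℝ (Fin 3)) → ℝ}
    (hΦ : ∀ v : UnitAddTorus (Fin 3) → EuclideanSpace ℝ (Fin 3), Torus.IsSmooth v →
      Torus.IsDivFree v → Φ v = ∫ x, g (strainFlat v x) ^ q)
    {v : UnitAddTorus (Fin 3) → EuclideanSpace ℝ (Fin 3)} (hv : Torus.IsSmooth v)
    (hdiv : Torus.IsDivFree v) {δ : ℝ} (hδ : 0 < δ) :
    ∃ τ : ℝ, 0 < τ ∧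
      heatDissipation Φ v - δ ≤ (Φ v - Φ (v + τ • Torus.laplacian v)) / τ := by
  have hv1 : Torus.IsContDiff 1 v := hv.isContDiff (by simp)
  have hΔ1 : Torus.IsContDiff 1 (Torus.laplacian v) := hv.laplacian.isContDiff (by simp)
  -- convexity of `t ↦ Φ(v + tΔv)`
  set φ : ℝ → ℝ := fun t => Φ (v + t • Torus.laplacian v) with hφ
  have hcvx : ConvexOn ℝ univ φ := by
    have h := convexOn_integral_posPart_rpow_line (d := Fin 3) hconv hgc
      (continuous_strainFlat hv) (continuous_strainFlat hv.laplacian) hq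
    refine h.congr fun t _ => ?_
    have hvt : Torus.IsSmooth (v + t • Torus.laplacian v) := isSmooth_heatLine hv t
    have hdt : Torus.IsDivFree (v + t • Torus.laplacian v) :=
      isDivFree_add_smul hv hv.laplacian hdiv (isDivFree_laplacian hv hdiv) t
    show (∫ x, max (g (strainFlat v x + t • strainFlat (Torus.laplacian v) x)) 0 ^ q) = φ t
    rw [hφ]
    simp only
    rw [hΦ _ hvt hdt]
    refine integral_congr_ae (ae_of_all _ fun x => ?_)
    show max (g (strainFlat v x + t • strainFlat (Torus.laplacian v) x)) 0 ^ q =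
      g (strainFlat (v + t • Torus.laplacian v) x) ^ q
    rw [← strainFlat_add_smul hv1 hΔ1, max_eq_left (hg0 _ hvt hdt x)]
  obtain ⟨hder, heq⟩ := heatDissipation_eq_neg_rightDeriv hcvx
  set D := derivWithin φ (Set.Ioi 0) 0 with hD
  have ht := (hasDerivWithinAt_iff_tendsto_slope' self_notMem_Ioi).mp hder
  have hev : ∀ᶠ τ in 𝓝[>] (0 : ℝ), dist (slope φ 0 τ) D < δ := Metric.tendsto_nhds.1 ht δ hδ
  obtain ⟨τ, hτd, hτ0⟩ := (hev.and self_mem_nhdsWithin).exists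
  refine ⟨τ, hτ0, ?_⟩
  have hφ0 : φ 0 = Φ v := by simp [hφ]
  have hsl : slope φ 0 τ = -((Φ v - Φ (v + τ • Torus.laplacian v)) / τ) := by
    rw [slope_def_field, hφ0, sub_zero]
    show (Φ (v + τ • Torus.laplacian v) - Φ v) / τ = _
    ring
  rw [Real.dist_eq, hsl, abs_lt] at hτd
  rw [heq]
  linarith [hτd.1, hτd.2]

/-! ## 3. The slope lemma -/

/-- **The slope lemma** (module docstring). Hypotheses: the ε-uniform inequality `hunif` for every
`τ > 0` (from `TopEig.weight_deriv_le_uniform`), `Φ = ∫ g(S)^q` on smooth divergence-free fields,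
Lemma L-λ at rate `c` for `Φ`, `2β ≤ (1 − β)c`, `g(S) ≤ |S|` (so `∫g(S)² ≤ ℰ ≤ 2ℰ`); conclusion: at
`x ∈ [a, b)`, if `K_c ν^{−γ} (2ℰ(u σ)) Φ(u σ)^{1+1/σ} ≤ K` on `[a, b]` then every `r > K` bounds the
right slopes of `s ↦ Φ(u s)` at `x` eventually. [ours] -/
theorem slope_lt_of_heatCoercive {q : ℝ} (hq : 2 ≤ q) {β c Kc ν a b : ℝ} (hν : 0 < ν) (hab : a < b)
    (hβ0 : 0 < β) (hβ1 : β ≤ 1) (hβc : 2 * β ≤ (1 - β) * c) (hKc0 : 0 ≤ Kc)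
    {u : ℝ → UnitAddTorus (Fin 3) → EuclideanSpace ℝ (Fin 3)} {p : ℝ → UnitAddTorus (Fin 3) → ℝ}
    (hsol : Torus.IsClassicalNSSolutionOn (Icc a b) ν 0 u p)
    (hmean : ∀ t ∈ Icc a b, Torus.HasZeroMean (u t))
    {g : EuclideanSpace ℝ (Fin 3 × Fin 3) → ℝ} (hconv : ConvexOn ℝ univ g) (hlip : LipschitzWith 1 g)
    (hg0 : ∀ v : UnitAddTorus (Fin 3) → EuclideanSpace ℝ (Fin 3), Torus.IsSmooth v →
      Torus.IsDivFree v → ∀ x, 0 ≤ g (strainFlat v x))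
    (hgle : ∀ v : UnitAddTorus (Fin 3) → EuclideanSpace ℝ (Fin 3), Torus.IsSmooth v →
      Torus.IsDivFree v → ∀ x, g (strainFlat v x) ≤ ‖strainFlat v x‖)
    {Φ : (UnitAddTorus (Fin 3) → EuclideanSpace ℝ (Fin 3)) → ℝ}
    (hΦ : ∀ v : UnitAddTorus (Fin 3) → EuclideanSpace ℝ (Fin 3), Torus.IsSmooth v →
      Torus.IsDivFree v → Φ v = ∫ x, g (strainFlat v x) ^ q)
    (hL : HeatCoercive (d := Fin 3) Φ c)
    (hunif : ∀ τ : ℝ, 0 < τ → ∃ C : ℝ, 0 ≤ C ∧ ∀ (ε : ℝ) (hε : 0 < ε), ε ≤ 1 → ∀ σ ∈ Icc a b,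
      (∫ y, g (strainFlat (u σ) y) ^ q) ≤ (∫ y, weight (bumpOf ε hε) g q (strainFlat (u σ) y)) ∧
      (∫ y, weight (bumpOf ε hε) g q (strainFlat (u σ) y)) - (∫ y, g (strainFlat (u σ) y) ^ q) ≤
        C * ε ∧
      ∃ D : ℝ, HasDerivWithinAt (fun s => ∫ y, weight (bumpOf ε hε) g q (strainFlat (u s) y)) D
          (Icc a b) σ ∧
        D ≤ -(ν * (1 - β)) * (((∫ y, g (strainFlat (u σ) y) ^ q) -
              ∫ y, g (strainFlat (u σ + τ • Torus.laplacian (u σ)) y) ^ q) / τ) +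
            2 * β * ν * (∫ y, g (strainFlat (u σ) y) ^ q) +
            Kc * ν ^ (-((3 * q - 3) / (2 * q - 3))) *
              ((∫ y, g (strainFlat (u σ) y) ^ (2 : ℝ)) *
                (∫ y, g (strainFlat (u σ) y) ^ q) ^ (1 + (2 * q - 3)⁻¹)) + C * ε)
    {K : ℝ} (hK : ∀ σ ∈ Icc a b, Kc * ν ^ (-((3 * q - 3) / (2 * q - 3))) *
      ((2 * torusEnstrophy (u σ)) * Φ (u σ) ^ (1 + (2 * q - 3)⁻¹)) ≤ K)
    {x : ℝ} (hx : x ∈ Ico a b) {r : ℝ} (hr : K < r) :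
    ∀ᶠ z in 𝓝[>] x, slope (fun s => Φ (u s)) x z < r := by
  have hq0 : 0 < q := by linarith
  have hq1 : (1 : ℝ) ≤ q := by linarith
  have hU : UniqueDiffOn ℝ (Icc a b) := uniqueDiffOn_Icc hab
  have hu : Torus.IsSmoothSpaceTimeOn (Icc a b) u := hsol.smooth_velocity
  have hgc : Continuous g := hlip.continuous
  have hxab : x ∈ Icc a b := Ico_subset_Icc_self hx
  have hux : Torus.IsSmooth (u x) := hu.isSmooth_slice hxab
  have hdivx : Torus.IsDivFree (u x) := hsol.divFree x hxab
  set γ : ℝ := (3 * q - 3) / (2 * q - 3) with hγ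
  set pq : ℝ := 1 + (2 * q - 3)⁻¹ with hpq
  -- the functional along the solution, in integral form
  set f : ℝ → ℝ := fun s => ∫ y, g (strainFlat (u s) y) ^ q with hf
  have hfΦ : ∀ s ∈ Icc a b, Φ (u s) = f s := fun s hs =>
    hΦ (u s) (hu.isSmooth_slice hs) (hsol.divFree s hs)
  have hf0 : ∀ s ∈ Icc a b, 0 ≤ f s := fun s hs =>
    integral_nonneg fun y => Real.rpow_nonneg (hg0 _ (hu.isSmooth_slice hs) (hsol.divFree s hs) y) _
  -- Step 1: `δ` and `τ` at the point `x`
  set δ : ℝ := (r - K) / (4 * ν) with hδ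
  have hδ0 : 0 < δ := by rw [hδ]; exact div_pos (by linarith) (by positivity)
  have hνδ : ν * δ = (r - K) / 4 := by
    rw [hδ]; field_simp
  have h3δ : 3 * ν * δ < r - K := by
    have e : 3 * ν * δ = 3 * ((r - K) / 4) := by rw [← hνδ]; ring
    rw [e]; linarith
  obtain ⟨τ, hτ0, hτ⟩ := exists_heatLine_quotient_ge hq1 hconv hgc hg0 hΦ hux hdivx hδ0
  have hLx : c * Φ (u x) ≤ heatDissipation Φ (u x) := hL (by simp) (u x) hux hdivx (hmean x hxab)
  -- the quotient `Q σ = (f σ - f_τ σ)/τ` and its continuity at `x`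
  set fτ : ℝ → ℝ := fun s => ∫ y, g (strainFlat (u s + τ • Torus.laplacian (u s)) y) ^ q with hfτ
  have huτ : Torus.IsSmoothSpaceTimeOn (Icc a b) (fun s => u s + τ • Torus.laplacian (u s)) :=
    hu.add ((hu.laplacian hU).const_smul τ)
  have hfc : ContinuousOn f (Icc a b) := continuousOn_integral_comp_strain hU hu hgc hq0.le
  have hfτc : ContinuousOn fτ (Icc a b) := continuousOn_integral_comp_strain hU huτ hgc hq0.le
  have hQx : c * f x - δ ≤ (f x - fτ x) / τ := by
    have hvx : Torus.IsSmooth (u x + τ • Torus.laplacian (u x)) := isSmooth_heatLine hux τ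
    have hdvx : Torus.IsDivFree (u x + τ • Torus.laplacian (u x)) :=
      isDivFree_add_smul hux hux.laplacian hdivx (isDivFree_laplacian hux hdivx) τ
    rw [← hfΦ x hxab, hfτ]
    simp only
    rw [← hΦ _ hvx hdvx]
    linarith
  -- continuity: `h₀` such that the lower bound `Q σ ≥ c f σ - 3δ` holds on `[x, x + h₀)`
  have hQc : ContinuousWithinAt (fun s => (f s - fτ s) / τ) (Icc a b) x :=
    ((hfc x hxab).sub (hfτc x hxab)).div_const τ
  obtain ⟨h₁, hh₁, hQ₁⟩ := Metric.continuousWithinAt_iff.1 hQc δ hδ0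
  have hcf : ContinuousWithinAt (fun s => c * f s) (Icc a b) x := (hfc x hxab).const_smul c
  obtain ⟨h₂, hh₂, hQ₂⟩ := Metric.continuousWithinAt_iff.1 hcf δ hδ0
  set h₀ : ℝ := min h₁ h₂ with hh₀
  have hh₀0 : 0 < h₀ := lt_min hh₁ hh₂
  have hlow : ∀ σ ∈ Icc a b, dist σ x < h₀ → c * f σ - 3 * δ ≤ (f σ - fτ σ) / τ := by
    intro σ hσ hd
    have h1 := hQ₁ hσ (lt_of_lt_of_le hd (min_le_left _ _))
    have h2 := hQ₂ hσ (lt_of_lt_of_le hd (min_le_right _ _))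
    rw [Real.dist_eq, abs_lt] at h1 h2
    linarith [h1.1, h2.2]
  -- Step 2: the ε-uniform inequality for this `τ`
  obtain ⟨C, hC0, hC⟩ := hunif τ hτ0
  -- Step 3: the slope bound on `(x, x + h₀) ∩ (x, b)`
  have hxb : x < b := hx.2
  set z₀ : ℝ := min (x + h₀) b with hz₀
  have hxz₀ : x < z₀ := lt_min (by linarith) hxb
  have hmem : Ioo x z₀ ∈ 𝓝[>] x := Ioo_mem_nhdsGT hxz₀
  filter_upwards [hmem] with z hz
  have hxz : x < z := hz.1
  have hzb : z ≤ b := (le_of_lt hz.2).trans (min_le_right _ _)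
  have hzab : z ∈ Icc a b := ⟨hxab.1.trans hxz.le, hzb⟩
  have hzx' : z - x < h₀ := by linarith [lt_of_lt_of_le hz.2 (min_le_left _ _)]
  -- the derivative bound on `[x, z]`: `D ≤ 3νδ + K + Cε`
  have hDle : ∀ (ε : ℝ) (hε : 0 < ε), ε ≤ 1 → ∀ σ ∈ Icc x z, ∃ D : ℝ,
      HasDerivWithinAt (fun s => ∫ y, weight (bumpOf ε hε) g q (strainFlat (u s) y)) D (Icc a b) σ ∧
        D ≤ 3 * ν * δ + K + C * ε := by
    intro ε hε hε1 σ hσ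
    have hσab : σ ∈ Icc a b := ⟨hxab.1.trans hσ.1, hσ.2.trans hzb⟩
    obtain ⟨_, _, D, hD, hDle⟩ := hC ε hε hε1 σ hσab
    refine ⟨D, hD, ?_⟩
    have hσx : dist σ x < h₀ := by
      rw [Real.dist_eq, abs_of_nonneg (by linarith [hσ.1])]
      linarith [hσ.2, hzx']
    have hQσ := hlow σ hσab hσx
    have hfσ0 : 0 ≤ f σ := hf0 σ hσab
    -- `∫ g(S)² ≤ 2ℰ`
    have huσ : Torus.IsSmooth (u σ) := hu.isSmooth_slice hσab
    have hdivσ : Torus.IsDivFree (u σ) := hsol.divFree σ hσab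
    have hZ : (∫ y, g (strainFlat (u σ) y) ^ (2 : ℝ)) ≤ 2 * torusEnstrophy (u σ) := by
      have h1 : (∫ y, g (strainFlat (u σ) y) ^ (2 : ℝ)) ≤ ∫ y, ‖strainFlat (u σ) y‖ ^ (2 : ℝ) :=
        integral_mono_of_nonneg (ae_of_all _ fun y => Real.rpow_nonneg (hg0 _ huσ hdivσ y) _)
          (((continuous_strainFlat huσ).norm.rpow_const fun _ => Or.inr (by norm_num)).integrable_unitAddTorus)
          (ae_of_all _ fun y => Real.rpow_le_rpow (hg0 _ huσ hdivσ y) (hgle _ huσ hdivσ y) (by norm_num))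
      rw [← torusEnstrophy_eq_integral_norm_sq huσ hdivσ] at h1
      linarith [torusEnstrophy_nonneg (u σ)]
    have hKσ := hK σ hσab
    rw [hfΦ σ hσab] at hKσ
    have hνγ : 0 ≤ Kc * ν ^ (-γ) := mul_nonneg hKc0 (Real.rpow_nonneg hν.le _)
    have hmain : Kc * ν ^ (-γ) * ((∫ y, g (strainFlat (u σ) y) ^ (2 : ℝ)) * f σ ^ pq) ≤ K := by
      refine le_trans ?_ hKσ
      exact mul_le_mul_of_nonneg_left (mul_le_mul_of_nonneg_right hZ (Real.rpow_nonneg hfσ0 _)) hνγ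
    have hlin : -(ν * (1 - β)) * ((f σ - fτ σ) / τ) + 2 * β * ν * f σ ≤ 3 * ν * δ := by
      have h1β : 0 ≤ ν * (1 - β) := mul_nonneg hν.le (by linarith)
      have h1 : -(ν * (1 - β)) * ((f σ - fτ σ) / τ) ≤ -(ν * (1 - β)) * (c * f σ - 3 * δ) := by
        have := mul_le_mul_of_nonneg_left hQσ h1β
        linarith
      have h2 : -(ν * (1 - β)) * (c * f σ - 3 * δ) + 2 * β * ν * f σ =
          -(ν * ((1 - β) * c - 2 * β)) * f σ + 3 * (ν * (1 - β)) * δ := by ring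
      have h3 : 0 ≤ ν * ((1 - β) * c - 2 * β) * f σ :=
        mul_nonneg (mul_nonneg hν.le (by linarith)) hfσ0
      have h4 : 3 * (ν * (1 - β)) * δ ≤ 3 * ν * δ := by
        have hνβ : 0 ≤ ν * β * δ := mul_nonneg (mul_nonneg hν.le hβ0.le) hδ0.le
        have e : 3 * (ν * (1 - β)) * δ = 3 * ν * δ - 3 * (ν * β * δ) := by ring
        rw [e]; linarith
      linarith
    linarith
  -- mean value inequality for `F_ε` on `[x, z]`, then `ε → 0`
  have hsub : ∀ (ε : ℝ) (hε : 0 < ε), ε ≤ 1 →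
      f z - f x ≤ (3 * ν * δ + K + C * ε) * (z - x) + C * ε := by
    intro ε hε hε1
    set Fε : ℝ → ℝ := fun s => ∫ y, weight (bumpOf ε hε) g q (strainFlat (u s) y) with hFε
    have hcont : ContinuousOn Fε (Icc x z) := by
      intro σ hσ
      obtain ⟨D, hD, _⟩ := hDle ε hε hε1 σ hσ
      exact (hD.continuousWithinAt).mono (Icc_subset_Icc hxab.1 hzb)
    have hdiff : DifferentiableOn ℝ Fε (interior (Icc x z)) := by
      rw [interior_Icc]
      intro σ hσ
      obtain ⟨D, hD, _⟩ := hDle ε hε hε1 σ (Ioo_subset_Icc_self hσ)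
      have hσab : Icc a b ∈ 𝓝 σ := Icc_mem_nhds (lt_of_le_of_lt hxab.1 hσ.1) (lt_of_lt_of_le hσ.2 hzb)
      exact (hD.hasDerivAt hσab).differentiableAt.differentiableWithinAt
    have hderiv : ∀ σ ∈ interior (Icc x z), deriv Fε σ ≤ 3 * ν * δ + K + C * ε := by
      rw [interior_Icc]
      intro σ hσ
      obtain ⟨D, hD, hle⟩ := hDle ε hε hε1 σ (Ioo_subset_Icc_self hσ)
      have hσab : Icc a b ∈ 𝓝 σ := Icc_mem_nhds (lt_of_le_of_lt hxab.1 hσ.1) (lt_of_lt_of_le hσ.2 hzb)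
      rw [(hD.hasDerivAt hσab).deriv]
      exact hle
    have hmv := (convex_Icc x z).image_sub_le_mul_sub_of_deriv_le hcont hdiff hderiv x
      (left_mem_Icc.2 hxz.le) z (right_mem_Icc.2 hxz.le) hxz.le
    obtain ⟨hlz, _, _⟩ := hC ε hε hε1 z hzab
    obtain ⟨_, hux', _⟩ := hC ε hε hε1 x hxab
    have e1 : f z ≤ Fε z := hlz
    have e2 : Fε x ≤ f x + C * ε := by linarith
    linarith
  have hfin : f z - f x ≤ (3 * ν * δ + K) * (z - x) := by
    refine le_of_forall_pos_le_add fun η hη => ?_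
    set ε : ℝ := min 1 (η / (C * (z - x) + C + 1)) with hεdef
    have hden : 0 < C * (z - x) + C + 1 := by
      have : 0 ≤ C * (z - x) := mul_nonneg hC0 (by linarith)
      linarith
    have hε0 : 0 < ε := lt_min one_pos (div_pos hη hden)
    have hε1 : ε ≤ 1 := min_le_left _ _
    have hεη : ε * (C * (z - x) + C + 1) ≤ η := by
      have := min_le_right 1 (η / (C * (z - x) + C + 1))
      rw [← hεdef] at this
      calc ε * (C * (z - x) + C + 1) ≤ η / (C * (z - x) + C + 1) * (C * (z - x) + C + 1) :=
            mul_le_mul_of_nonneg_right this hden.le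
        _ = η := div_mul_cancel₀ η hden.ne'
    have h := hsub ε hε0 hε1
    have e : (3 * ν * δ + K + C * ε) * (z - x) + C * ε =
        (3 * ν * δ + K) * (z - x) + ε * (C * (z - x) + C) := by ring
    rw [e] at h
    have h' : ε * (C * (z - x) + C) ≤ ε * (C * (z - x) + C + 1) :=
      mul_le_mul_of_nonneg_left (by linarith) hε0.le
    linarith
  -- conclusion
  rw [slope_def_field, hfΦ z hzab, hfΦ x hxab, div_lt_iff₀ (by linarith : 0 < z - x)]
  calc f z - f x ≤ (3 * ν * δ + K) * (z - x) := hfin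
    _ < r * (z - x) := mul_lt_mul_of_pos_right (by linarith) (by linarith)

/-! ## 4. Dini fencing -/

/-- **Fencing** (module docstring): under the hypotheses of the slope lemma, with the bound `K` on the
whole window, `Φ(u s) ≤ Φ(u a) + K (s − a)` for every `s ∈ [a, b]`. [ours] -/
theorem sub_le_mul_of_heatCoercive {q : ℝ} (hq : 2 ≤ q) {β c Kc ν a b : ℝ} (hν : 0 < ν) (hab : a < b)
    (hβ0 : 0 < β) (hβ1 : β ≤ 1) (hβc : 2 * β ≤ (1 - β) * c) (hKc0 : 0 ≤ Kc)
    {u : ℝ → UnitAddTorus (Fin 3) → EuclideanSpace ℝ (Fin 3)} {p : ℝ → UnitAddTorus (Fin 3) → ℝ}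
    (hsol : Torus.IsClassicalNSSolutionOn (Icc a b) ν 0 u p)
    (hmean : ∀ t ∈ Icc a b, Torus.HasZeroMean (u t))
    {g : EuclideanSpace ℝ (Fin 3 × Fin 3) → ℝ} (hconv : ConvexOn ℝ univ g) (hlip : LipschitzWith 1 g)
    (hg0 : ∀ v : UnitAddTorus (Fin 3) → EuclideanSpace ℝ (Fin 3), Torus.IsSmooth v →
      Torus.IsDivFree v → ∀ x, 0 ≤ g (strainFlat v x))
    (hgle : ∀ v : UnitAddTorus (Fin 3) → EuclideanSpace ℝ (Fin 3), Torus.IsSmooth v →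
      Torus.IsDivFree v → ∀ x, g (strainFlat v x) ≤ ‖strainFlat v x‖)
    {Φ : (UnitAddTorus (Fin 3) → EuclideanSpace ℝ (Fin 3)) → ℝ}
    (hΦ : ∀ v : UnitAddTorus (Fin 3) → EuclideanSpace ℝ (Fin 3), Torus.IsSmooth v →
      Torus.IsDivFree v → Φ v = ∫ x, g (strainFlat v x) ^ q)
    (hL : HeatCoercive (d := Fin 3) Φ c)
    (hunif : ∀ τ : ℝ, 0 < τ → ∃ C : ℝ, 0 ≤ C ∧ ∀ (ε : ℝ) (hε : 0 < ε), ε ≤ 1 → ∀ σ ∈ Icc a b,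
      (∫ y, g (strainFlat (u σ) y) ^ q) ≤ (∫ y, weight (bumpOf ε hε) g q (strainFlat (u σ) y)) ∧
      (∫ y, weight (bumpOf ε hε) g q (strainFlat (u σ) y)) - (∫ y, g (strainFlat (u σ) y) ^ q) ≤
        C * ε ∧
      ∃ D : ℝ, HasDerivWithinAt (fun s => ∫ y, weight (bumpOf ε hε) g q (strainFlat (u s) y)) D
          (Icc a b) σ ∧
        D ≤ -(ν * (1 - β)) * (((∫ y, g (strainFlat (u σ) y) ^ q) -
              ∫ y, g (strainFlat (u σ + τ • Torus.laplacian (u σ)) y) ^ q) / τ) +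
            2 * β * ν * (∫ y, g (strainFlat (u σ) y) ^ q) +
            Kc * ν ^ (-((3 * q - 3) / (2 * q - 3))) *
              ((∫ y, g (strainFlat (u σ) y) ^ (2 : ℝ)) *
                (∫ y, g (strainFlat (u σ) y) ^ q) ^ (1 + (2 * q - 3)⁻¹)) + C * ε)
    {K : ℝ} (hK : ∀ σ ∈ Icc a b, Kc * ν ^ (-((3 * q - 3) / (2 * q - 3))) *
      ((2 * torusEnstrophy (u σ)) * Φ (u σ) ^ (1 + (2 * q - 3)⁻¹)) ≤ K)
    {s : ℝ} (hs : s ∈ Icc a b) : Φ (u s) ≤ Φ (u a) + K * (s - a) := by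
  have hq0 : 0 < q := by linarith
  have hU : UniqueDiffOn ℝ (Icc a b) := uniqueDiffOn_Icc hab
  have hu : Torus.IsSmoothSpaceTimeOn (Icc a b) u := hsol.smooth_velocity
  have hgc : Continuous g := hlip.continuous
  -- continuity of `s ↦ Φ (u s)` on the window
  have hfc : ContinuousOn (fun s => Φ (u s)) (Icc a b) := by
    refine (continuousOn_integral_comp_strain hU hu hgc hq0.le).congr fun s hs => ?_
    exact hΦ (u s) (hu.isSmooth_slice hs) (hsol.divFree s hs)
  have hB : ContinuousOn (fun s => Φ (u a) + K * (s - a)) (Icc a b) := by fun_prop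
  have hB' : ∀ x ∈ Ico a b, HasDerivWithinAt (fun s => Φ (u a) + K * (s - a)) K (Ici x) x := by
    intro x _
    have h := (((hasDerivAt_id x).sub_const a).const_mul K).const_add (Φ (u a))
    simp only [mul_one] at h
    exact h.hasDerivWithinAt
  have hbound : ∀ x ∈ Ico a b, ∀ r, K < r →
      ∃ᶠ z in 𝓝[>] x, slope (fun s => Φ (u s)) x z < r := fun x hx r hr =>
    (slope_lt_of_heatCoercive hq hν hab hβ0 hβ1 hβc hKc0 hsol hmean hconv hlip hg0 hgle hΦ hL
      hunif hK hx hr).frequently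
  exact image_le_of_liminf_slope_right_le_deriv_boundary hfc (by simp) hB hB' hbound hs

end TopEig

end Summit.NavierStokesRegularity.FunctionalMining

end
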